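import Summits.QuantumFields.YangMills.Theorems.ColdStartUniversalityUniformColdStartMixingRungOfHarris
import Summits.QuantumFields.YangMills.Theorems.ColdStartUniversalityLatticeLangevinCocycleMain
import Summits.QuantumFields.YangMills.Theorems.ColdStartUniversalityLatticeLangevinLocalSmall
import HarnessLib

/-!
# Route `ColdStartUniversality` / `TransportPerturbation`: the named fact SZZ Lemma 3.3 (`WilsonMeasureLangevinInvariant`
# for `SU(2)`, `d = 3`) REDUCED to kernel invariance at short times on continuous observables

Helper file (seat `ym-line-csu-p1`, g5).  The one named fact on which the TP support item `GibbsInvariance`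
(stmt-QuantumFields-26921, file `TransportPerturbationGibbsInvarianceOfWilsonInvariant`) and the rung `stub_fixedCutoffMixing`
of crux K_A1 (stmt-QuantumFields-24809, files `…LatticeLangevinRungFinal` / `…CocycleMain`) are conditional is
`WilsonMeasureLangevinInvariant (fundamentalLatticeRep 2) 3 L β'` — invariance of the Wilson–Gibbs measure under the transition
operators of EVERY family of strong solutions of the Shen–Zhu–Zhu dynamics on EVERY probability space.  This file strips
the statement of all that bookkeeping, using the tree theorems `exists_transitionKernel` (THE transition kernels `κ_t` exist
as Markov kernels realising `law(U^x_t)` for every solution), `lawUnique_of_start` (inside it), `wilson_invariant_of_fact`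
and `chapmanKolmogorov_szz` (the Markov property `κ_{s+t} = κ_t ∘ₖ κ_s`):

* `wilsonMeasureLangevinInvariant_of_kernelInvariant` / `…_iff_kernelInvariant` — the fact is EQUIVALENT to
  `∀ t, Kernel.Invariant (κ t) μ_{β'}` for any (equivalently every) kernel family realising the transition laws;
* `kernelInvariant_of_forall_continuous` — invariance at time `t` follows from `∫∫ g dκ_t(x) dμ = ∫ g dμ` for CONTINUOUS `g`
  (finite Borel measures on the metrisable compact `SU(2)^E` are determined by continuous test functions);
* `kernelInvariant_of_smallTimes` — invariance at the times `0 < t ≤ δ` gives invariance at all times (`κ_0 = id`,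
  Chapman–Kolmogorov, `Kernel.Invariant.comp`);
* ★ `wilsonMeasureLangevinInvariant_of_family` — THE SOCKET for an analytic proof: if for ONE family of solutions `U^x` from
  the deterministic starts on ONE probability space, `∫ E g(U^x_t) dμ_{β'}(x) = ∫ g dμ_{β'}` for all continuous `g` and all
  `0 < t ≤ δ`, then `WilsonMeasureLangevinInvariant (fundamentalLatticeRep 2) 3 L β'` holds (no measurability in `x`, no
  other spaces, no long times, no indicator observables); `…_of_family_subalgebra` — the same with `g` ranging only over a
  POINT-SEPARATING SUBALGEBRA of `C(SU(2)^E, ℝ)` (Stone–Weierstrass; `kernelInvariant_of_forall_mem_subalgebra`).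

What remains OPEN is exactly the analytic content of SZZ Lemma 3.3 (Itô/Dynkin formula for the SZZ system + symmetry of
the generator `Σ_e Δ_e + ⟨∇𝒮, ∇⟩` in `L²(μ)` + a core/regularity statement); nothing of it is claimed here.  No definition,
no sorry.  RECORD-rung R3 plumbing; nothing here bears on the Yang–Mills mass gap.
References: H. Shen, R. Zhu, X. Zhu, CMP **400** (2023) [arXiv:2204.12737] §3 Lemma 3.3; M. Hairer, J. Mattingly,
*Yet another look at Harris' ergodic theorem* (2011) [arXiv:0810.2777] (kernel language).
-/

set_option autoImplicit false

noncomputable section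

namespace Summit.QuantumFields.YangMills.Theorems.ColdStartUniversality

open MeasureTheory ProbabilityTheory Filter Topology
open scoped NNReal ENNReal
open Literature.Probability.Process Literature.MathematicalPhysics.QuantumFieldTheory
open Literature.MathematicalPhysics.QuantumLattice (fundamentalRep fundamentalLatticeRep continuous_fundamentalRep)

variable (L : ℕ) [NeZero L] (β' : ℝ)

/-- **`κ_0 = id`** for every kernel family realising the transition laws of the `SU(2)` SZZ dynamics (the hypothesis
shape `hreal` shared with `chapmanKolmogorov_szz`, `wilson_invariant_of_fact`, `fixedCutoffMixing_of_doeblin`): evaluate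
`hreal` at `t = 0` on the canonical solution family of the product Wiener space. [folklore] -/
theorem transitionKernel_zero_eq_id
    (κ : ℝ≥0 → Kernel (GaugeConfig 3 L (Matrix.specialUnitaryGroup (Fin 2) ℂ))
      (GaugeConfig 3 L (Matrix.specialUnitaryGroup (Fin 2) ℂ)))
    (hreal : ∀ (t : ℝ≥0) (x : GaugeConfig 3 L (Matrix.specialUnitaryGroup (Fin 2) ℂ))
        (Ω : Type) [MeasurableSpace Ω] (P : Measure Ω) [IsProbabilityMeasure P]
        (W : ℝ≥0 → Ω → (Edge 3 L × NoiseIdx 2 → ℝ)) (hW : IsFlatBrownian W P)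
        (U : ℝ≥0 → Ω → GaugeConfig 3 L (Matrix.specialUnitaryGroup (Fin 2) ℂ)),
        (∀ ω, U 0 ω = x) →
        (latticeLangevinDynamics (fundamentalLatticeRep 2) β').IsSolution (fundamentalRep (Fin 2))
          hW.natFiltration P W U →
        κ t x = P.map (U t)) :
    κ 0 = Kernel.id := by
  classical
  haveI := isProbabilityMeasure_piWiener (Edge 3 L × NoiseIdx 2)
  have hWc := isFlatBrownian_piWiener 3 L (NoiseIdx 2)
  obtain ⟨Uc, hUc, -⟩ := latticeLangevinMeasurableFlow_su2 L β'
    (LatticeRep.isClassicalDefining_specialUnitaryGroup 2) _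
    (Measure.pi fun _ : Edge 3 L × NoiseIdx 2 => preWienerMeasure) _ hWc
  ext x : 1
  rw [hreal 0 x _ (Measure.pi fun _ : Edge 3 L × NoiseIdx 2 => preWienerMeasure) _ hWc (Uc x) (hUc x).1 (hUc x).2,
    Kernel.id_apply]
  have h0 : Uc x 0 = fun _ => x := funext (hUc x).1
  rw [h0, Measure.map_const, measure_univ, one_smul]

/-- **Kernel invariance ⇒ the named fact.**  If the Wilson measure `μ_{β'}` is invariant under a Markov kernel family
realising the transition laws of the `SU(2)` SZZ dynamics, then `WilsonMeasureLangevinInvariant (fundamentalLatticeRep 2) 3 L β'`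
holds: for EVERY solution family on EVERY space, `E f(U^x_t) = ∫ f dκ_t(x)` (`hreal` + change of variables), and
`∫∫ f dκ_t(x) dμ = ∫ f d(κ_t ∘ₘ μ) = ∫ f dμ`. [cite: ShenZhuZhu2022, §3 Lemma 3.3 (invariance of the lattice Yang–Mills measure; p. 13)] -/
theorem wilsonMeasureLangevinInvariant_of_kernelInvariant
    (κ : ℝ≥0 → Kernel (GaugeConfig 3 L (Matrix.specialUnitaryGroup (Fin 2) ℂ))
      (GaugeConfig 3 L (Matrix.specialUnitaryGroup (Fin 2) ℂ))) [∀ t, IsMarkovKernel (κ t)]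
    (hreal : ∀ (t : ℝ≥0) (x : GaugeConfig 3 L (Matrix.specialUnitaryGroup (Fin 2) ℂ))
        (Ω : Type) [MeasurableSpace Ω] (P : Measure Ω) [IsProbabilityMeasure P]
        (W : ℝ≥0 → Ω → (Edge 3 L × NoiseIdx 2 → ℝ)) (hW : IsFlatBrownian W P)
        (U : ℝ≥0 → Ω → GaugeConfig 3 L (Matrix.specialUnitaryGroup (Fin 2) ℂ)),
        (∀ ω, U 0 ω = x) →
        (latticeLangevinDynamics (fundamentalLatticeRep 2) β').IsSolution (fundamentalRep (Fin 2))
          hW.natFiltration P W U →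
        κ t x = P.map (U t))
    (hinv : ∀ t, Kernel.Invariant (κ t) (wilsonMeasure (d := 3) (L := L) (fundamentalRep (Fin 2)) β')) :
    WilsonMeasureLangevinInvariant (fundamentalLatticeRep 2) 3 L β' := by
  intro _ Ω _ P _ W hW U hU f hf hbd t
  haveI : IsProbabilityMeasure (wilsonMeasure (d := 3) (L := L) (fundamentalRep (Fin 2)) β') :=
    isProbabilityMeasure_wilsonMeasure (d := 3) (L := L) (fundamentalRep (Fin 2)) (continuous_fundamentalRep (Fin 2)) β'
  obtain ⟨C, hC⟩ := hbd
  have hmU : ∀ x, Measurable (U x t) := fun x => ((hU x).2.adapted t).mono (hW.natFiltration.le t) le_rfl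
  have hpt : (fun x => markovTransition U P t f x) = fun x => ∫ y, f y ∂(κ t x) := by
    funext x
    show ∫ ω, f (U x t ω) ∂P = ∫ y, f y ∂(κ t x)
    rw [hreal t x Ω P W hW (U x) (hU x).1 (hU x).2, integral_map (hmU x).aemeasurable hf.aestronglyMeasurable]
  have hfi : Integrable f ((κ t) ∘ₘ wilsonMeasure (d := 3) (L := L) (fundamentalRep (Fin 2)) β') :=
    (integrable_const C).mono' hf.aestronglyMeasurable (ae_of_all _ fun y => by rw [Real.norm_eq_abs]; exact hC y)
  have hcomp : ∫ y, f y ∂((κ t) ∘ₘ wilsonMeasure (d := 3) (L := L) (fundamentalRep (Fin 2)) β') =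
      ∫ x, ∫ y, f y ∂(κ t x) ∂(wilsonMeasure (d := 3) (L := L) (fundamentalRep (Fin 2)) β') := by
    rw [Measure.comp_eq_comp_const_apply] at hfi ⊢
    rw [Kernel.integral_comp hfi, Kernel.const_apply]
  show ∫ x, markovTransition U P t f x ∂(wilsonMeasure (d := 3) (L := L) (fundamentalRep (Fin 2)) β') = _
  rw [hpt, ← hcomp]
  exact congrArg (fun ν => ∫ y, f y ∂ν) (hinv t).def

/-- **SZZ Lemma 3.3 for `SU(2)`, `d = 3` ⇔ kernel invariance** of the Wilson measure for any Markov kernel family realising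
the transition laws (one direction is the tree's `wilson_invariant_of_fact`).  Such families exist (`exists_transitionKernel`)
and are unique (`lawUnique_of_start`). [cite: ShenZhuZhu2022, §3 Lemma 3.3 (p. 13)] -/
theorem wilsonMeasureLangevinInvariant_iff_kernelInvariant
    (κ : ℝ≥0 → Kernel (GaugeConfig 3 L (Matrix.specialUnitaryGroup (Fin 2) ℂ))
      (GaugeConfig 3 L (Matrix.specialUnitaryGroup (Fin 2) ℂ))) [∀ t, IsMarkovKernel (κ t)]
    (hreal : ∀ (t : ℝ≥0) (x : GaugeConfig 3 L (Matrix.specialUnitaryGroup (Fin 2) ℂ))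
        (Ω : Type) [MeasurableSpace Ω] (P : Measure Ω) [IsProbabilityMeasure P]
        (W : ℝ≥0 → Ω → (Edge 3 L × NoiseIdx 2 → ℝ)) (hW : IsFlatBrownian W P)
        (U : ℝ≥0 → Ω → GaugeConfig 3 L (Matrix.specialUnitaryGroup (Fin 2) ℂ)),
        (∀ ω, U 0 ω = x) →
        (latticeLangevinDynamics (fundamentalLatticeRep 2) β').IsSolution (fundamentalRep (Fin 2))
          hW.natFiltration P W U →
        κ t x = P.map (U t)) :
    WilsonMeasureLangevinInvariant (fundamentalLatticeRep 2) 3 L β' ↔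
      ∀ t, Kernel.Invariant (κ t) (wilsonMeasure (d := 3) (L := L) (fundamentalRep (Fin 2)) β') :=
  ⟨fun h t => wilson_invariant_of_fact L β' h κ hreal t,
    fun h => wilsonMeasureLangevinInvariant_of_kernelInvariant L β' κ hreal h⟩

/-- **Invariance is decided on continuous observables**: a Markov kernel on the (compact, metrisable) configuration space
`SU(2)^E` leaves the Wilson measure invariant as soon as `∫∫ g dκ(x) dμ = ∫ g dμ` for every continuous `g`
(`ext_of_forall_integral_eq_of_IsFiniteMeasure`, `HasOuterApproxClosed` from `hasOuterApproxClosed_config`). [folklore] -/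
theorem kernelInvariant_of_forall_continuous
    (κ : Kernel (GaugeConfig 3 L (Matrix.specialUnitaryGroup (Fin 2) ℂ))
      (GaugeConfig 3 L (Matrix.specialUnitaryGroup (Fin 2) ℂ))) [IsMarkovKernel κ]
    (h : ∀ g : GaugeConfig 3 L (Matrix.specialUnitaryGroup (Fin 2) ℂ) → ℝ, Continuous g →
      ∫ x, ∫ y, g y ∂(κ x) ∂(wilsonMeasure (d := 3) (L := L) (fundamentalRep (Fin 2)) β') =
        ∫ y, g y ∂(wilsonMeasure (d := 3) (L := L) (fundamentalRep (Fin 2)) β')) :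
    Kernel.Invariant κ (wilsonMeasure (d := 3) (L := L) (fundamentalRep (Fin 2)) β') := by
  haveI : IsProbabilityMeasure (wilsonMeasure (d := 3) (L := L) (fundamentalRep (Fin 2)) β') :=
    isProbabilityMeasure_wilsonMeasure (d := 3) (L := L) (fundamentalRep (Fin 2)) (continuous_fundamentalRep (Fin 2)) β'
  haveI := hasOuterApproxClosed_config L
  show (Measure.bind (wilsonMeasure (d := 3) (L := L) (fundamentalRep (Fin 2)) β') κ) = _
  haveI := secondCountableTopology_su2
  haveI := borelSpace_config L
  refine ext_of_forall_integral_eq_of_IsFiniteMeasure fun g => ?_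
  have hgi : Integrable (⇑g) (κ ∘ₘ wilsonMeasure (d := 3) (L := L) (fundamentalRep (Fin 2)) β') :=
    (integrable_const ‖g‖).mono' g.continuous.measurable.aestronglyMeasurable
      (ae_of_all _ fun y => g.norm_coe_le_norm y)
  have hcomp : ∫ y, g y ∂(κ ∘ₘ wilsonMeasure (d := 3) (L := L) (fundamentalRep (Fin 2)) β') =
      ∫ x, ∫ y, g y ∂(κ x) ∂(wilsonMeasure (d := 3) (L := L) (fundamentalRep (Fin 2)) β') := by
    rw [Measure.comp_eq_comp_const_apply] at hgi ⊢
    rw [Kernel.integral_comp hgi, Kernel.const_apply]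
  exact hcomp.trans (h g g.continuous)

/-- **Invariance at short times gives invariance at all times**: `κ_0 = id` (`hreal` at `t = 0` on the canonical solution
family) and Chapman–Kolmogorov `κ_{ms+s} = κ_s ∘ₖ κ_{ms}` (`chapmanKolmogorov_szz`), with `Kernel.Invariant.comp`;
every `t > 0` is `n • (t/n)` with `t/n ≤ δ`. [cite: ShenZhuZhu2022, §3 (Markov semigroup P_t^L after Lemma 3.3, p. 13)] -/
theorem kernelInvariant_of_smallTimes
    (κ : ℝ≥0 → Kernel (GaugeConfig 3 L (Matrix.specialUnitaryGroup (Fin 2) ℂ))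
      (GaugeConfig 3 L (Matrix.specialUnitaryGroup (Fin 2) ℂ))) [∀ t, IsMarkovKernel (κ t)]
    (hreal : ∀ (t : ℝ≥0) (x : GaugeConfig 3 L (Matrix.specialUnitaryGroup (Fin 2) ℂ))
        (Ω : Type) [MeasurableSpace Ω] (P : Measure Ω) [IsProbabilityMeasure P]
        (W : ℝ≥0 → Ω → (Edge 3 L × NoiseIdx 2 → ℝ)) (hW : IsFlatBrownian W P)
        (U : ℝ≥0 → Ω → GaugeConfig 3 L (Matrix.specialUnitaryGroup (Fin 2) ℂ)),
        (∀ ω, U 0 ω = x) →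
        (latticeLangevinDynamics (fundamentalLatticeRep 2) β').IsSolution (fundamentalRep (Fin 2))
          hW.natFiltration P W U →
        κ t x = P.map (U t))
    {δ : ℝ≥0} (hδ : 0 < δ)
    (h : ∀ t : ℝ≥0, 0 < t → t ≤ δ →
      Kernel.Invariant (κ t) (wilsonMeasure (d := 3) (L := L) (fundamentalRep (Fin 2)) β'))
    (t : ℝ≥0) : Kernel.Invariant (κ t) (wilsonMeasure (d := 3) (L := L) (fundamentalRep (Fin 2)) β') := by
  have h0 : Kernel.Invariant (κ 0) (wilsonMeasure (d := 3) (L := L) (fundamentalRep (Fin 2)) β') := by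
    rw [Kernel.Invariant, transitionKernel_zero_eq_id L β' κ hreal]
    exact Measure.id_comp
  rcases eq_zero_or_pos t with ht | ht
  · rw [ht]; exact h0
  obtain ⟨n, hn⟩ := exists_nat_ge ((t : ℝ) / δ)
  have hδr : (0 : ℝ) < δ := by exact_mod_cast hδ
  have htr : (0 : ℝ) < t := by exact_mod_cast ht
  have hnr : (0 : ℝ) < n := lt_of_lt_of_le (div_pos htr hδr) hn
  have hn0 : (0 : ℝ≥0) < n := by exact_mod_cast hnr
  set s : ℝ≥0 := t / n with hs
  have hs0 : 0 < s := div_pos ht hn0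
  have hsδ : s ≤ δ := by
    rw [hs, div_le_iff₀ hn0, ← NNReal.coe_le_coe, NNReal.coe_mul]
    calc (t : ℝ) = (t : ℝ) / δ * δ := by rw [div_mul_cancel₀ _ hδr.ne']
      _ ≤ n * δ := mul_le_mul_of_nonneg_right hn hδr.le
      _ = (δ : ℝ) * (n : ℝ≥0) := by rw [mul_comm]; norm_cast
  have hts : t = n • s := by
    rw [hs, nsmul_eq_mul, mul_div_cancel₀ _ hn0.ne']
  have hind : ∀ m : ℕ, Kernel.Invariant (κ (m • s)) (wilsonMeasure (d := 3) (L := L) (fundamentalRep (Fin 2)) β') := by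
    intro m
    induction m with
    | zero => rw [zero_nsmul]; exact h0
    | succ m ih =>
      rw [succ_nsmul, chapmanKolmogorov_szz β' κ hreal (m • s) s]
      exact (h s hs0 hsδ).comp ih
  rw [hts]
  exact hind n

/-- ★ **THE SOCKET FOR SZZ LEMMA 3.3 (`SU(2)`, `d = 3`)**: if for ONE family `U^x` of strong solutions of the SZZ dynamics from
the deterministic starts, on ONE probability space with one flat driver, the Wilson measure is preserved IN THE MEAN ON
CONTINUOUS OBSERVABLES AT SHORT TIMES — `∫ E g(U^x_t) dμ_{β'}(x) = ∫ g dμ_{β'}` for all continuous `g` and `0 < t ≤ δ` —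
then the named fact `WilsonMeasureLangevinInvariant (fundamentalLatticeRep 2) 3 L β'` holds (all families, all spaces,
all bounded measurable observables, all times): transition kernels (`exists_transitionKernel`), continuity test
(`kernelInvariant_of_forall_continuous`), short times (`kernelInvariant_of_smallTimes`), kernel form
(`wilsonMeasureLangevinInvariant_of_kernelInvariant`). [cite: ShenZhuZhu2022, §3 Lemma 3.3 (p. 13)] -/
theorem wilsonMeasureLangevinInvariant_of_family
    {Ω : Type} [MeasurableSpace Ω] (P : Measure Ω) [IsProbabilityMeasure P]
    (W : ℝ≥0 → Ω → (Edge 3 L × NoiseIdx 2 → ℝ)) (hW : IsFlatBrownian W P)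
    (U : GaugeConfig 3 L (Matrix.specialUnitaryGroup (Fin 2) ℂ) → ℝ≥0 → Ω →
      GaugeConfig 3 L (Matrix.specialUnitaryGroup (Fin 2) ℂ))
    (hU : ∀ x, (∀ ω, U x 0 ω = x) ∧
      (latticeLangevinDynamics (fundamentalLatticeRep 2) β').IsSolution (fundamentalRep (Fin 2))
        hW.natFiltration P W (U x))
    {δ : ℝ≥0} (hδ : 0 < δ)
    (h : ∀ t : ℝ≥0, 0 < t → t ≤ δ → ∀ g : GaugeConfig 3 L (Matrix.specialUnitaryGroup (Fin 2) ℂ) → ℝ, Continuous g →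
      ∫ x, (∫ ω, g (U x t ω) ∂P) ∂(wilsonMeasure (d := 3) (L := L) (fundamentalRep (Fin 2)) β') =
        ∫ x, g x ∂(wilsonMeasure (d := 3) (L := L) (fundamentalRep (Fin 2)) β')) :
    WilsonMeasureLangevinInvariant (fundamentalLatticeRep 2) 3 L β' := by
  obtain ⟨κ, hκM, -, hreal⟩ := exists_transitionKernel L β'
  haveI := hκM
  haveI := secondCountableTopology_su2
  haveI := borelSpace_config L
  refine wilsonMeasureLangevinInvariant_of_kernelInvariant L β' κ hreal
    (kernelInvariant_of_smallTimes L β' κ hreal hδ fun t ht htδ =>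
      kernelInvariant_of_forall_continuous L β' (κ t) fun g hg => ?_)
  have hmU : ∀ x, Measurable (U x t) := fun x => ((hU x).2.adapted t).mono (hW.natFiltration.le t) le_rfl
  have hpt : (fun x => ∫ y, g y ∂(κ t x)) = fun x => ∫ ω, g (U x t ω) ∂P := by
    funext x
    rw [hreal t x Ω P W hW (U x) (hU x).1 (hU x).2,
      integral_map (hmU x).aemeasurable hg.measurable.aestronglyMeasurable]
  rw [hpt]
  exact h t ht htδ g hg

/-! ## Invariance decided on a point-separating subalgebra of observables (Stone–Weierstrass) -/

/-- Integration against a finite Borel measure is a (Lipschitz) continuous functional on `C(X, ℝ)`, `X` compact. [folklore] -/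
theorem continuous_integral_continuousMap {X : Type*} [TopologicalSpace X] [CompactSpace X] [MeasurableSpace X]
    [OpensMeasurableSpace X] (ν : Measure X) [IsFiniteMeasure ν] :
    Continuous fun g : C(X, ℝ) => ∫ x, g x ∂ν := by
  have hint : ∀ g : C(X, ℝ), Integrable (fun x => g x) ν := fun g =>
    (integrable_const ‖g‖).mono' g.continuous.measurable.aestronglyMeasurable
      (ae_of_all _ fun x => g.norm_coe_le_norm x)
  refine (LipschitzWith.of_dist_le_mul (K := (ν.real Set.univ).toNNReal) fun g g' => ?_).continuous
  rw [Real.dist_eq, ← integral_sub (hint g) (hint g'), Real.coe_toNNReal _ measureReal_nonneg, dist_eq_norm, mul_comm]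
  have h := norm_integral_le_of_norm_le_const (μ := ν) (f := fun x => g x - g' x) (C := ‖g - g'‖)
    (ae_of_all _ fun x => (g - g').norm_coe_le_norm x)
  rwa [Real.norm_eq_abs] at h

/-- **Invariance is decided on any point-separating subalgebra of continuous observables** (e.g. polynomials in the
matrix entries, or smooth cylinder functions — the natural domain of an Itô/Dynkin computation): if
`∫∫ g dκ(x) dμ = ∫ g dμ` for all `g` in a subalgebra `A ⊆ C(SU(2)^E, ℝ)` separating points, then `κ` leaves the Wilson
measure invariant (Stone–Weierstrass density of `A`, continuity of `g ↦ ∫ g dν`, then `kernelInvariant_of_forall_continuous`).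
[folklore] -/
theorem kernelInvariant_of_forall_mem_subalgebra
    (κ : Kernel (GaugeConfig 3 L (Matrix.specialUnitaryGroup (Fin 2) ℂ))
      (GaugeConfig 3 L (Matrix.specialUnitaryGroup (Fin 2) ℂ))) [IsMarkovKernel κ]
    (A : Subalgebra ℝ C(GaugeConfig 3 L (Matrix.specialUnitaryGroup (Fin 2) ℂ), ℝ)) (hA : A.SeparatesPoints)
    (h : ∀ g ∈ A, ∫ x, ∫ y, g y ∂(κ x) ∂(wilsonMeasure (d := 3) (L := L) (fundamentalRep (Fin 2)) β') =
        ∫ y, g y ∂(wilsonMeasure (d := 3) (L := L) (fundamentalRep (Fin 2)) β')) :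
    Kernel.Invariant κ (wilsonMeasure (d := 3) (L := L) (fundamentalRep (Fin 2)) β') := by
  haveI : IsProbabilityMeasure (wilsonMeasure (d := 3) (L := L) (fundamentalRep (Fin 2)) β') :=
    isProbabilityMeasure_wilsonMeasure (d := 3) (L := L) (fundamentalRep (Fin 2)) (continuous_fundamentalRep (Fin 2)) β'
  haveI := secondCountableTopology_su2
  haveI := borelSpace_config L
  set μ := wilsonMeasure (d := 3) (L := L) (fundamentalRep (Fin 2)) β' with hμ
  -- the iterated integral is the integral against `κ ∘ₘ μ`
  have hcomp : ∀ g : C(GaugeConfig 3 L (Matrix.specialUnitaryGroup (Fin 2) ℂ), ℝ),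
      ∫ y, g y ∂(κ ∘ₘ μ) = ∫ x, ∫ y, g y ∂(κ x) ∂μ := fun g => by
    have hgi : Integrable (⇑g) (κ ∘ₘ μ) :=
      (integrable_const ‖g‖).mono' g.continuous.measurable.aestronglyMeasurable
        (ae_of_all _ fun y => g.norm_coe_le_norm y)
    rw [Measure.comp_eq_comp_const_apply] at hgi ⊢
    rw [Kernel.integral_comp hgi, Kernel.const_apply]
  -- the set of observables on which invariance holds is closed and contains `A`, hence everything
  have hS : IsClosed {f : C(GaugeConfig 3 L (Matrix.specialUnitaryGroup (Fin 2) ℂ), ℝ) |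
      ∫ y, f y ∂(κ ∘ₘ μ) = ∫ y, f y ∂μ} :=
    isClosed_eq (continuous_integral_continuousMap _) (continuous_integral_continuousMap _)
  have hAS : (A : Set C(GaugeConfig 3 L (Matrix.specialUnitaryGroup (Fin 2) ℂ), ℝ)) ⊆
      {f | ∫ y, f y ∂(κ ∘ₘ μ) = ∫ y, f y ∂μ} := fun f hf => by
    show ∫ y, f y ∂(κ ∘ₘ μ) = ∫ y, f y ∂μ
    rw [hcomp]
    exact h f hf
  refine kernelInvariant_of_forall_continuous L β' κ fun g hg => ?_
  have hmem : (⟨g, hg⟩ : C(GaugeConfig 3 L (Matrix.specialUnitaryGroup (Fin 2) ℂ), ℝ)) ∈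
      (A.topologicalClosure : Set C(GaugeConfig 3 L (Matrix.specialUnitaryGroup (Fin 2) ℂ), ℝ)) := by
    rw [ContinuousMap.subalgebra_topologicalClosure_eq_top_of_separatesPoints A hA]
    trivial
  rw [Subalgebra.topologicalClosure_coe] at hmem
  have hg' := closure_minimal hAS hS hmem
  have hc := hcomp ⟨g, hg⟩
  simp only [Set.mem_setOf_eq, ContinuousMap.coe_mk] at hg' hc
  rw [← hc]
  exact hg'

/-- ★ **THE SOCKET, subalgebra form**: if for ONE family of strong solutions on ONE probability space the Wilson measure is
preserved in the mean AT SHORT TIMES on a POINT-SEPARATING SUBALGEBRA of continuous observables —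
`∫ E g(U^x_t) dμ_{β'}(x) = ∫ g dμ_{β'}` for `g ∈ A`, `0 < t ≤ δ` — then `WilsonMeasureLangevinInvariant (fundamentalLatticeRep 2) 3 L β'`.
This is the exact shape an Itô/Dynkin-formula proof of SZZ Lemma 3.3 delivers (polynomial or smooth cylinder observables,
the canonical solution family, small times). [cite: ShenZhuZhu2022, §3 Lemma 3.3 (p. 13)] -/
theorem wilsonMeasureLangevinInvariant_of_family_subalgebra
    {Ω : Type} [MeasurableSpace Ω] (P : Measure Ω) [IsProbabilityMeasure P]
    (W : ℝ≥0 → Ω → (Edge 3 L × NoiseIdx 2 → ℝ)) (hW : IsFlatBrownian W P)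
    (U : GaugeConfig 3 L (Matrix.specialUnitaryGroup (Fin 2) ℂ) → ℝ≥0 → Ω →
      GaugeConfig 3 L (Matrix.specialUnitaryGroup (Fin 2) ℂ))
    (hU : ∀ x, (∀ ω, U x 0 ω = x) ∧
      (latticeLangevinDynamics (fundamentalLatticeRep 2) β').IsSolution (fundamentalRep (Fin 2))
        hW.natFiltration P W (U x))
    (A : Subalgebra ℝ C(GaugeConfig 3 L (Matrix.specialUnitaryGroup (Fin 2) ℂ), ℝ)) (hA : A.SeparatesPoints)
    {δ : ℝ≥0} (hδ : 0 < δ)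
    (h : ∀ t : ℝ≥0, 0 < t → t ≤ δ → ∀ g ∈ A,
      ∫ x, (∫ ω, g (U x t ω) ∂P) ∂(wilsonMeasure (d := 3) (L := L) (fundamentalRep (Fin 2)) β') =
        ∫ x, g x ∂(wilsonMeasure (d := 3) (L := L) (fundamentalRep (Fin 2)) β')) :
    WilsonMeasureLangevinInvariant (fundamentalLatticeRep 2) 3 L β' := by
  obtain ⟨κ, hκM, -, hreal⟩ := exists_transitionKernel L β'
  haveI := hκM
  haveI := secondCountableTopology_su2
  haveI := borelSpace_config L
  refine wilsonMeasureLangevinInvariant_of_kernelInvariant L β' κ hreal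
    (kernelInvariant_of_smallTimes L β' κ hreal hδ fun t ht htδ =>
      kernelInvariant_of_forall_mem_subalgebra L β' (κ t) A hA fun g hg => ?_)
  have hmU : ∀ x, Measurable (U x t) := fun x => ((hU x).2.adapted t).mono (hW.natFiltration.le t) le_rfl
  have hpt : (fun x => ∫ y, g y ∂(κ t x)) = fun x => ∫ ω, g (U x t ω) ∂P := by
    funext x
    rw [hreal t x Ω P W hW (U x) (hU x).1 (hU x).2,
      integral_map (hmU x).aemeasurable g.continuous.measurable.aestronglyMeasurable]
  rw [hpt]
  exact h t ht htδ g hg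

end Summit.QuantumFields.YangMills.Theorems.ColdStartUniversality

end
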